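import Literature.NumberTheory.GaloisRepresentations.DecompositionGroupCommTerminal
import HarnessLib

/-!
# Nested decomposition groups are equal: `D_𝔓 ≤ D_𝔔 ⇒ 𝔓 = 𝔔` for primes of `K̄` over a number field

Topic `NumberTheory/GaloisRepresentations`; theorems only (no definition, no named fact), sequel of
`DecompositionGroupCommTerminal.lean` (notation as there: `K` a number field, `Γ_K = Gal(K̄/K)`,
`\bar ℤ_K = absIntegers (𝓞 K) K`, `v`, `w` finite places, `K_v = v.adicCompletion K`,
`ι_v : K̄ → \bar K_v`, `res_v : Γ_{K_v} → Γ_K`, `𝔓₀(v) = adicCompletionPrime K v` with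
`D_{𝔓₀(v)} = res_v (Γ_{K_v})`).

* **`not_decompositionSubgroup_le_of_ne`** — if `v ≠ w`, `𝔓 ∣ v`, `𝔔 ∣ w`, then `D_𝔓 ≰ D_𝔔`.
  Proof (the number-field case of F. K. Schmidt's theorem / [NSW] Cor. 12.1.3 for primes over
  DIFFERENT places, by explicit arithmetic): choose `a ∈ 𝓞 K` with `ord_v a = 1` and `a ≡ 1 (mod w)`
  (Chinese remainder theorem) and a prime `ℓ` invertible in `O_w`; by Hensel `a` is an `ℓ`-th power
  in `K_w`, so (`Z₀(w) = ι_w⁻¹(K_w)` is relatively algebraically closed) `a = z ^ ℓ` with `z` in the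
  decomposition field of `𝔓₀(w)`, fixed by `D_{𝔓₀(w)} ⊇ D_𝔓 = τ D_{𝔓₀(v)} τ⁻¹`; hence `ι_v (τ⁻¹ z) ∈ K_v`
  is an `ℓ`-th root of `a` in `K_v` — impossible, `‖a‖_v = q_v⁻¹` is not an `ℓ`-th power in `q_v^ℤ`.
* **`eq_of_decompositionSubgroup_le`** — for arbitrary primes `𝔓 ∣ v`, `𝔔 ∣ w` of `\bar ℤ_K`:
  `D_𝔓 ≤ D_𝔔 ⇒ 𝔓 = 𝔔` (different places: the previous theorem; the same place: `𝔔 = σ 𝔓` and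
  `D_𝔓 ≤ D_{σ𝔓}` gives relative index `1`, so `σ 𝔓 = 𝔓` by
  `smul_eq_of_relIndex_ne_zero_of_mem_primesAbove`).  Corollaries: `D_𝔓 = D_𝔔 ⇒ 𝔓 = 𝔔`
  (`eq_of_decompositionSubgroup_eq`), and `v = w`.
* **`map_decompositionSubgroup_eq_of_forall_exists_le`** — the GROUP-THEORETIC STEP of Neukirch's
  theorem ([NSW] (12.1.9)–(12.2.1)): for an automorphism `α` of `Γ_K`, IF `α` and `α⁻¹` map every
  decomposition group INTO some decomposition group (the cohomological containment lemma
  [NSW] (12.1.9), taken here as an explicit hypothesis), THEN `α` maps every decomposition group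
  ONTO a decomposition group: `α(D_𝔓) = D_𝔔`.

HONEST FRAMING: classical, undisputed algebraic number theory (our kernel check of refereed
statements); the containment lemma [NSW] (12.1.9) itself is NOT proved here.  Written for the abc-iut
cell's GAP-LEDGER row G-L4d2g4-1 («campaign L»); nothing here bears on [IUTchIII] Cor. 3.12.

## References

* J. Neukirch, A. Schmidt, K. Wingberg, *Cohomology of Number Fields*, Grundlehren 323 (2nd ed.
  2008), Cor. 12.1.3, Prop. 12.1.9, Thm. 12.2.1. [NeukirchSchmidtWingberg2008]
* J. Neukirch, *Algebraic Number Theory*, Grundlehren 322 (1999), Ch. II §9 (9.6); Ch. II (4.6).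
  [NeukirchANT1999]
-/

noncomputable section

open scoped NumberField Pointwise Valued
open Field IsDedekindDomain Polynomial

universe u

namespace Literature.NumberTheory.GaloisRepresentations

variable (K : Type u) [Field K] [NumberField K]

/-! ### A global element which is a uniformiser at `v` and a principal unit at `w` -/

/-- Chinese remainder theorem in `𝓞 K`: for distinct finite places `v ≠ w` of `K` there is
`a ∈ 𝓞 K` with `ord_v (a) = 1` (`v.intValuation a = exp (-1)`) and `a ≡ 1 (mod w)` (solve
`a ≡ π_v (mod v²)`, `a ≡ 1 (mod w)`).  Neukirch, *Algebraic Number Theory*, Ch. I §3, Thm. (3.6).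
[cite: NeukirchANT1999, Ch. I §3 Thm. (3.6)] -/
theorem exists_intValuation_eq_exp_neg_one_and_sub_one_mem {v w : HeightOneSpectrum (𝓞 K)}
    (hvw : v ≠ w) :
    ∃ a : 𝓞 K, v.intValuation a = WithZero.exp (-1 : ℤ) ∧ a - 1 ∈ w.asIdeal := by
  classical
  obtain ⟨π, hπ⟩ := v.intValuation_exists_uniformizer
  let s : Finset (HeightOneSpectrum (𝓞 K)) := {v, w}
  obtain ⟨y, hy⟩ := IsDedekindDomain.exists_forall_sub_mem_ideal (s := s)
    (fun u : HeightOneSpectrum (𝓞 K) => u.asIdeal) (fun u => if u = v then 2 else 1)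
    (fun u _ => u.prime) (fun u _ u' _ huu' h => huu' (HeightOneSpectrum.ext h))
    (fun u => if (u : HeightOneSpectrum (𝓞 K)) = v then π else 1)
  have hv : y - π ∈ v.asIdeal ^ 2 := by
    simpa [s] using hy v (by simp [s])
  have hw : y - 1 ∈ w.asIdeal := by
    simpa [s, hvw.symm] using hy w (by simp [s])
  refine ⟨y, ?_, hw⟩
  have hlt : v.intValuation (y - π) < v.intValuation π := by
    rw [hπ]
    refine lt_of_le_of_lt ((v.intValuation_le_pow_iff_mem (y - π) 2).mpr hv) ?_
    exact WithZero.exp_lt_exp.mpr (by norm_num)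
  have e : y = π + (y - π) := by ring
  rw [e, Valuation.map_add_eq_of_lt_left _ hlt, hπ]


/-! ### No `ℓ`-th roots of a uniformiser in `K_v` -/

/-- An element of `K_v` of valuation `exp (-1)` (a uniformiser) is not an `ℓ`-th power in `K_v` for
`ℓ ≥ 2`: the value group of `K_v` is `ℤ` and `-1` is not divisible by `ℓ`.
Neukirch, *Algebraic Number Theory*, Ch. II §5. [cite: NeukirchANT1999, Ch. II §5 Prop. (5.2)] -/
theorem pow_ne_of_valued_eq_exp_neg_one (v : HeightOneSpectrum (𝓞 K)) {x : v.adicCompletion K}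
    (hx : Valued.v x = WithZero.exp (-1 : ℤ)) {ℓ : ℕ} (hℓ : 2 ≤ ℓ) (y : v.adicCompletion K) :
    y ^ ℓ ≠ x := by
  intro h
  have hy0 : Valued.v y ≠ 0 := by
    intro h0
    have : Valued.v x = 0 := by rw [← h, map_pow, h0, zero_pow (by omega)]
    rw [hx] at this
    exact WithZero.coe_ne_zero this
  have hval : (Valued.v y) ^ ℓ = WithZero.exp (-1 : ℤ) := by rw [← map_pow, h, hx]
  rw [← WithZero.coe_unzero hy0, ← WithZero.coe_pow, WithZero.exp, WithZero.coe_inj, ← ofAdd_toAdd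
    (WithZero.unzero hy0), ← ofAdd_nsmul] at hval
  have hval' : ℓ • Multiplicative.toAdd (WithZero.unzero hy0) = (-1 : ℤ) :=
    Multiplicative.ofAdd.injective hval
  rw [nsmul_eq_mul] at hval'
  -- `ℓ * n = -1` with `ℓ ≥ 2`: impossible
  have hdvd : (ℓ : ℤ) ∣ 1 := ⟨-(Multiplicative.toAdd (WithZero.unzero hy0)), by linarith⟩
  have h1 : (ℓ : ℤ) = 1 := Int.eq_one_of_dvd_one (Int.natCast_nonneg ℓ) hdvd
  omega

/-! ### Different places: `D_𝔓 ≰ D_𝔔` -/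

/-- The valuation in `K_w` of a global integer congruent to `1 (mod w)`: `‖a - 1‖_w < 1`. [folklore] -/
private theorem norm_algebraMap_sub_one_lt {w : HeightOneSpectrum (𝓞 K)} {a : 𝓞 K}
    (haw : a - 1 ∈ w.asIdeal) : ‖algebraMap K (w.adicCompletion K) (a : K) - 1‖ < 1 := by
  rw [Valued.toNormedField.norm_lt_one_iff, ← map_one (algebraMap K (w.adicCompletion K)),
    ← map_sub]
  have e : ((a : K) - 1) = algebraMap (𝓞 K) K (a - 1) := by simp
  have hv : Valued.v (algebraMap K (w.adicCompletion K) ((a : K) - 1)) = w.valuation K ((a : K) - 1) :=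
    HeightOneSpectrum.valuedAdicCompletion_eq_valuation' w _
  rw [hv, e]
  exact (w.valuation_lt_one_iff_mem (a - 1)).mpr haw

-- the pointwise `MulAction` of `Γ_K` on the ideals of `\bar ℤ_K` is slow to synthesise
set_option synthInstance.maxHeartbeats 160000 in
/-- **Core case.**  For `v ≠ w` and any prime `𝔓 ∣ v` of `\bar ℤ_K`, the decomposition group `D_𝔓`
is not contained in `D_{𝔓₀(w)}`, the decomposition group of the prime of `K̄` above `w` cut out by
`K̄ → \bar K_w` (see the module docstring for the proof).  [NSW] Cor. 12.1.3 (number-field case,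
primes over different places; F. K. Schmidt). [cite: NeukirchSchmidtWingberg2008, Cor. 12.1.3] -/
theorem not_decompositionSubgroup_le_adicCompletionPrime_of_ne {v w : HeightOneSpectrum (𝓞 K)}
    (hvw : v ≠ w) {𝔓 : Ideal (absIntegers (𝓞 K) K)} (h𝔓 : 𝔓 ∈ v.primesAbove) :
    ¬ 𝔓.decompositionSubgroup (absoluteGaloisGroup K) ≤
      (adicCompletionPrime K w).decompositionSubgroup (absoluteGaloisGroup K) := by
  intro hle
  -- a global integer which is a uniformiser at `v` and a principal unit at `w`, and a prime `ℓ ∤ N w`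
  obtain ⟨a, hav, haw⟩ := exists_intValuation_eq_exp_neg_one_and_sub_one_mem K hvw
  obtain ⟨ℓ, hℓ, hℓu⟩ := exists_prime_isUnit_natCast K w
  -- Hensel at `w`: `a = r ^ ℓ` in `K_w`
  obtain ⟨r, hr⟩ := exists_pow_eq_of_norm_sub_one_lt K w (norm_algebraMap_sub_one_lt K haw) hℓu
  -- the root is algebraic, hence `r = ι_w z` with `z ∈ K̄`, `z ^ ℓ = a`
  have hrℓ : algebraMap (w.adicCompletion K) (AlgebraicClosure (w.adicCompletion K)) r ^ ℓ =
      absClosureEmbedding K (w.adicCompletion K) (algebraMap K (AlgebraicClosure K) (a : K)) := by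
    rw [← map_pow, hr, AlgHom.commutes, IsScalarTower.algebraMap_apply K (w.adicCompletion K)
      (AlgebraicClosure (w.adicCompletion K))]
  obtain ⟨z, hz, hzℓ⟩ := exists_eq_absClosureEmbedding_of_pow_eq K w hℓ.pos hrℓ
  -- `z` lies in the decomposition field of `𝔓₀(w)`: it is fixed by `D_{𝔓₀(w)} = res_w (Γ_{K_w})`
  have hzfix : ∀ g ∈ (adicCompletionPrime K w).decompositionSubgroup (absoluteGaloisGroup K),
      g • z = z := by
    intro g hg
    rw [decompositionSubgroup_adicCompletionPrime_eq_range] at hg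
    obtain ⟨τ', rfl⟩ := hg
    exact absGaloisRestrict_smul_eq_of_mem_range K w τ' ⟨r, hz.symm⟩
  -- `𝔓 = τ • 𝔓₀(v)`, so `D_𝔓 = τ D_{𝔓₀(v)} τ⁻¹ = τ res_v(Γ_{K_v}) τ⁻¹`
  obtain ⟨τ, hτ⟩ := HeightOneSpectrum.exists_smul_eq_of_mem_primesAbove_holds
    (adicCompletionPrime_mem_primesAbove K v) h𝔓
  -- `u := τ⁻¹ • z` is fixed by `res_v (Γ_{K_v})`
  have hufix : ∀ τ' : absoluteGaloisGroup (v.adicCompletion K),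
      absGaloisRestrict K (v.adicCompletion K) τ' • (τ⁻¹ • z) = τ⁻¹ • z := by
    intro τ'
    have hmem : τ * absGaloisRestrict K (v.adicCompletion K) τ' * τ⁻¹ ∈
        𝔓.decompositionSubgroup (absoluteGaloisGroup K) := by
      rw [← hτ, Ideal.decompositionSubgroup_smul (absoluteGaloisGroup K) _ τ,
        Subgroup.mem_pointwise_smul_iff_inv_smul_mem, ← map_inv, MulAut.smul_def,
        MulAut.conj_apply, decompositionSubgroup_adicCompletionPrime_eq_range]
      refine ⟨τ', ?_⟩
      change absGaloisRestrict K (v.adicCompletion K) τ' = _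
      group
    have h1 := hzfix _ (hle hmem)
    rw [mul_smul, mul_smul] at h1
    calc absGaloisRestrict K (v.adicCompletion K) τ' • (τ⁻¹ • z)
        = τ⁻¹ • (τ • (absGaloisRestrict K (v.adicCompletion K) τ' • (τ⁻¹ • z))) := by
          rw [inv_smul_smul]
      _ = τ⁻¹ • z := by rw [h1]
  -- hence `ι_v u ∈ K_v`, an `ℓ`-th root of `a` in `K_v`
  obtain ⟨y, hy⟩ := mem_range_of_forall_absGaloisRestrict_smul_eq K v hufix
  have hyℓ : y ^ ℓ = algebraMap K (v.adicCompletion K) (a : K) := by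
    apply (algebraMap (v.adicCompletion K) (AlgebraicClosure (v.adicCompletion K))).injective
    rw [map_pow, hy, ← map_pow, absoluteGaloisGroup.smul_def, ← map_pow, hzℓ, AlgEquiv.commutes,
      AlgHom.commutes, IsScalarTower.algebraMap_apply K (v.adicCompletion K)
        (AlgebraicClosure (v.adicCompletion K))]
  -- contradiction: `ord_v a = 1` is not divisible by `ℓ ≥ 2`
  have hval : Valued.v (algebraMap K (v.adicCompletion K) (a : K)) = WithZero.exp (-1 : ℤ) := by
    have hv : Valued.v (algebraMap K (v.adicCompletion K) (a : K)) = v.valuation K (a : K) :=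
      HeightOneSpectrum.valuedAdicCompletion_eq_valuation' v _
    rw [hv, show ((a : K)) = algebraMap (𝓞 K) K a from rfl, HeightOneSpectrum.valuation_of_algebraMap,
      hav]
  exact pow_ne_of_valued_eq_exp_neg_one K v hval hℓ.two_le y hyℓ


omit [NumberField K] in
/-- `Γ_K` permutes the primes of `\bar ℤ_K` above `v` (cf. `smul_mem_primesAbove` of
`AbsIntegersEquiv.lean`, re-proved here to keep the imports of this file small). [folklore] -/
private theorem smul_mem_primesAbove' {v : HeightOneSpectrum (𝓞 K)} {𝔓 : Ideal (absIntegers (𝓞 K) K)}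
    (h𝔓 : 𝔓 ∈ v.primesAbove) (g : absoluteGaloisGroup K) : g • 𝔓 ∈ v.primesAbove := by
  haveI := h𝔓.1
  refine ⟨Ideal.IsPrime.smul g, ⟨?_⟩⟩
  rw [Ideal.under_smul, h𝔓.2.over]

-- the pointwise `MulAction` of `Γ_K` on the ideals of `\bar ℤ_K` is slow to synthesise
set_option synthInstance.maxHeartbeats 160000 in
/-- **Decomposition groups of primes over different places are not nested**: if `v ≠ w`,
`𝔓 ∣ v` and `𝔔 ∣ w` are primes of `\bar ℤ_K`, then `D_𝔓 ≰ D_𝔔` (reduce to `𝔔 = 𝔓₀(w)` by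
conjugating: `𝔔 = σ 𝔓₀(w)`, `D_𝔔 = σ D_{𝔓₀(w)} σ⁻¹`, `σ⁻¹ D_𝔓 σ = D_{σ⁻¹ 𝔓}`).  [NSW] Cor. 12.1.3
(number-field case; F. K. Schmidt's theorem). [cite: NeukirchSchmidtWingberg2008, Cor. 12.1.3] -/
theorem not_decompositionSubgroup_le_of_ne {v w : HeightOneSpectrum (𝓞 K)} (hvw : v ≠ w)
    {𝔓 𝔔 : Ideal (absIntegers (𝓞 K) K)} (h𝔓 : 𝔓 ∈ v.primesAbove) (h𝔔 : 𝔔 ∈ w.primesAbove) :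
    ¬ 𝔓.decompositionSubgroup (absoluteGaloisGroup K) ≤ 𝔔.decompositionSubgroup (absoluteGaloisGroup K) := by
  intro hle
  obtain ⟨σ, hσ⟩ := HeightOneSpectrum.exists_smul_eq_of_mem_primesAbove_holds
    (adicCompletionPrime_mem_primesAbove K w) h𝔔
  apply not_decompositionSubgroup_le_adicCompletionPrime_of_ne K hvw (smul_mem_primesAbove' K h𝔓 σ⁻¹)
  have h1 : (MulAut.conj σ)⁻¹ • 𝔓.decompositionSubgroup (absoluteGaloisGroup K) ≤
      (MulAut.conj σ)⁻¹ • 𝔔.decompositionSubgroup (absoluteGaloisGroup K) :=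
    Subgroup.pointwise_smul_le_pointwise_smul_iff.mpr hle
  rwa [← hσ, Ideal.decompositionSubgroup_smul (absoluteGaloisGroup K) _ σ, inv_smul_smul, ← map_inv,
    ← Ideal.decompositionSubgroup_smul (absoluteGaloisGroup K) 𝔓 σ⁻¹] at h1

-- the pointwise `MulAction` of `Γ_K` on the ideals of `\bar ℤ_K` is slow to synthesise
set_option synthInstance.maxHeartbeats 160000 in
/-- **Nested decomposition groups are equal.**  For primes `𝔓 ∣ v`, `𝔔 ∣ w` of `\bar ℤ_K` over a
number field `K`: `D_𝔓 ≤ D_𝔔 ⇒ 𝔓 = 𝔔`.  Different places are excluded by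
`not_decompositionSubgroup_le_of_ne`; over the same place `𝔔 = σ 𝔓` and `D_𝔓 ≤ D_{σ 𝔓}` makes the
relative index of `D_{σ𝔓} ∩ D_𝔓` in `D_𝔓` equal to `1`, so `σ 𝔓 = 𝔓`
(`smul_eq_of_relIndex_ne_zero_of_mem_primesAbove`).  [NSW] Cor. 12.1.3.
[cite: NeukirchSchmidtWingberg2008, Cor. 12.1.3] -/
theorem eq_of_decompositionSubgroup_le {v w : HeightOneSpectrum (𝓞 K)}
    {𝔓 𝔔 : Ideal (absIntegers (𝓞 K) K)} (h𝔓 : 𝔓 ∈ v.primesAbove) (h𝔔 : 𝔔 ∈ w.primesAbove)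
    (hle : 𝔓.decompositionSubgroup (absoluteGaloisGroup K) ≤ 𝔔.decompositionSubgroup (absoluteGaloisGroup K)) :
    𝔓 = 𝔔 := by
  by_cases hvw : v = w
  · subst hvw
    obtain ⟨σ, hσ⟩ := HeightOneSpectrum.exists_smul_eq_of_mem_primesAbove_holds h𝔓 h𝔔
    have hidx : ((σ • 𝔓).decompositionSubgroup (absoluteGaloisGroup K)).relIndex
        (𝔓.decompositionSubgroup (absoluteGaloisGroup K)) ≠ 0 := by
      rw [hσ, Subgroup.relIndex_eq_one.mpr hle]
      exact one_ne_zero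
    rw [← hσ, smul_eq_of_relIndex_ne_zero_of_mem_primesAbove K v h𝔓 σ hidx]
  · exact absurd hle (not_decompositionSubgroup_le_of_ne K hvw h𝔓 h𝔔)

/-- The places agree as well: `D_𝔓 ≤ D_𝔔 ⇒ v = w` (for `𝔓 ∣ v`, `𝔔 ∣ w`).
[cite: NeukirchSchmidtWingberg2008, Cor. 12.1.3] -/
theorem place_eq_of_decompositionSubgroup_le {v w : HeightOneSpectrum (𝓞 K)}
    {𝔓 𝔔 : Ideal (absIntegers (𝓞 K) K)} (h𝔓 : 𝔓 ∈ v.primesAbove) (h𝔔 : 𝔔 ∈ w.primesAbove)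
    (hle : 𝔓.decompositionSubgroup (absoluteGaloisGroup K) ≤ 𝔔.decompositionSubgroup (absoluteGaloisGroup K)) :
    v = w := by
  by_contra hvw
  exact not_decompositionSubgroup_le_of_ne K hvw h𝔓 h𝔔 hle

/-- **Decomposition groups determine their prime**: `D_𝔓 = D_𝔔 ⇒ 𝔓 = 𝔔` for primes of `\bar ℤ_K`
above finite places of the number field `K`.  [NSW] Cor. 12.1.3.
[cite: NeukirchSchmidtWingberg2008, Cor. 12.1.3] -/
theorem eq_of_decompositionSubgroup_eq {v w : HeightOneSpectrum (𝓞 K)}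
    {𝔓 𝔔 : Ideal (absIntegers (𝓞 K) K)} (h𝔓 : 𝔓 ∈ v.primesAbove) (h𝔔 : 𝔔 ∈ w.primesAbove)
    (heq : 𝔓.decompositionSubgroup (absoluteGaloisGroup K) = 𝔔.decompositionSubgroup (absoluteGaloisGroup K)) :
    𝔓 = 𝔔 :=
  eq_of_decompositionSubgroup_le K h𝔓 h𝔔 heq.le

/-! ### The group-theoretic step of Neukirch's theorem -/

/-- **From containment to equality** (the group-theoretic step of Neukirch's theorem, [NSW]
(12.1.9) ⇒ (12.2.1)).  Let `α` be a group automorphism of `Γ_K`.  Suppose that `α` maps the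
decomposition group of every prime of `\bar ℤ_K` (above a finite place) INTO the decomposition group
of some such prime, and that `α⁻¹` does too (this containment is the cohomological lemma [NSW]
Prop. 12.1.9, an explicit hypothesis here).  Then `α` maps every decomposition group ONTO a
decomposition group: `α(D_𝔓) ≤ D_𝔔`, `α⁻¹(D_𝔔) ≤ D_{𝔓'}` give `D_𝔓 ≤ D_{𝔓'}`, hence equality
throughout by `eq_of_decompositionSubgroup_le`. [cite: NeukirchSchmidtWingberg2008, Thm. 12.2.1] -/
theorem map_decompositionSubgroup_eq_of_forall_exists_le (α : absoluteGaloisGroup K ≃* absoluteGaloisGroup K)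
    (hα : ∀ (v : HeightOneSpectrum (𝓞 K)) (𝔓 : Ideal (absIntegers (𝓞 K) K)), 𝔓 ∈ v.primesAbove →
      ∃ (w : HeightOneSpectrum (𝓞 K)) (𝔔 : Ideal (absIntegers (𝓞 K) K)), 𝔔 ∈ w.primesAbove ∧
        (𝔓.decompositionSubgroup (absoluteGaloisGroup K)).map α.toMonoidHom ≤
          𝔔.decompositionSubgroup (absoluteGaloisGroup K))
    (hα' : ∀ (v : HeightOneSpectrum (𝓞 K)) (𝔓 : Ideal (absIntegers (𝓞 K) K)), 𝔓 ∈ v.primesAbove →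
      ∃ (w : HeightOneSpectrum (𝓞 K)) (𝔔 : Ideal (absIntegers (𝓞 K) K)), 𝔔 ∈ w.primesAbove ∧
        (𝔓.decompositionSubgroup (absoluteGaloisGroup K)).map α.symm.toMonoidHom ≤
          𝔔.decompositionSubgroup (absoluteGaloisGroup K))
    {v : HeightOneSpectrum (𝓞 K)} {𝔓 : Ideal (absIntegers (𝓞 K) K)} (h𝔓 : 𝔓 ∈ v.primesAbove) :
    ∃ (w : HeightOneSpectrum (𝓞 K)) (𝔔 : Ideal (absIntegers (𝓞 K) K)), 𝔔 ∈ w.primesAbove ∧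
      (𝔓.decompositionSubgroup (absoluteGaloisGroup K)).map α.toMonoidHom =
        𝔔.decompositionSubgroup (absoluteGaloisGroup K) := by
  obtain ⟨w, 𝔔, h𝔔, hle⟩ := hα v 𝔓 h𝔓
  obtain ⟨v', 𝔓', h𝔓', hle'⟩ := hα' w 𝔔 h𝔔
  refine ⟨w, 𝔔, h𝔔, le_antisymm hle ?_⟩
  -- `D_𝔓 ≤ α⁻¹(D_𝔔) ≤ D_{𝔓'}`, hence `𝔓 = 𝔓'` and both inclusions are equalities
  have h1 : 𝔓.decompositionSubgroup (absoluteGaloisGroup K) ≤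
      (𝔔.decompositionSubgroup (absoluteGaloisGroup K)).map α.symm.toMonoidHom := by
    intro g hg
    refine ⟨α g, hle ⟨g, hg, rfl⟩, ?_⟩
    simp
  have h2 := eq_of_decompositionSubgroup_le K h𝔓 h𝔓' (h1.trans hle')
  subst h2
  -- now `α⁻¹(D_𝔔) ≤ D_𝔓`, i.e. `D_𝔔 ≤ α(D_𝔓)`
  intro g hg
  obtain ⟨g', hg', hgg'⟩ := hle' ⟨g, hg, rfl⟩ |> fun h => (⟨α.symm g, h, by simp⟩ :
    ∃ g', g' ∈ 𝔓.decompositionSubgroup (absoluteGaloisGroup K) ∧ α g' = g)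
  exact ⟨g', hg', hgg'⟩

end Literature.NumberTheory.GaloisRepresentations

end
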